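import Summits.Ventures.Crystal3D.Theorems.StickyWulffConstantCoaxialWallLawSeamGlideCensusSoundC
import Summits.Ventures.Crystal3D.Theorems.StickyWulffConstantCoaxialWallLawSeamGlideCensusCertData
import Summits.Ventures.Crystal3D.Theorems.StickyWulffConstantCoaxialWallLawSeamThreePayerSplit
import HarnessLib

/-!
# GLIDE CENSUS: the kernel check of the certificate and `SatCensus11Glide` from E1, GAP(5/2), the twin vacancy cap, the two hex cap rows and the pocket rows
# (crux `CoaxialWallLaw`, stmt-Ventures-19481; lane F 'Certificates' v8.7, registered stub `stub_satCensus11Glide : TailResidue.SatCensus11Glide`)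

HONEST FRAMING. Venture `Summits/Ventures/Crystal3D` (cell `crystal3d-full`); helper for `stub_satCensus11Glide`; sequel of '…SeamGlideCensusSoundC' and
'…SeamGlideCensusCertData' (seat 19481-p2 g16), the GLIDE analogue of '…SeamFullCensusCert' (seat 19481-p2 g15).
* `certGlide_ok : runG certGlide initG = true` — the kernel evaluates the checker on the certificate (`decide +kernel`, ≈ 25 s);
* `inv_initG`, **`engineG`** — under E1, GAP(5/2), `VacancyCapTwin`, `HexVacancyCap`, `HexBlockedCap`, `GlidePocketCap`: a `1`-separated `X` containing the
  reader `q₀` TWIN-READING the base frame across the cube normal `0` (nine own slot balls and three mirror balls present, the three far slots absent) whose in-plane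
  neighbour `T (gBase 1)` has exactly eleven contacts, any two unsaturated ones of which coincide, is contradictory;
* `glideSymList` / `glide_sym_table` — for each of the 48 (slot, orthogonal cube normal) pairs a chain of rational model reflections carrying the base pair (slot `1`,
  normal `0`) to it, permuting the slots, preserving the menu values and carrying mirrors to mirrors (one kernel `decide`);
* **`satCensus11Glide_of_inputs : P5Exhaustion → KissingGap (5/2) → VacancyCapTwin → HexVacancyCap → HexBlockedCap → GlidePocketCap → SatCensus11Glide`** —
  at a deg-11 (A)-end ball `b = q + d` of a GLIDE move (admissible slot class `(G, d)`, twin reading `(G, m)` of `q` with `⟪d, m⟫ = 0`) two distinct contact-neighbours of `b`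
  have at most eleven contacts.  `KissingGap (5/2)` is `kissingGap_250` (`stub_gap`) and `VacancyCapTwin` is registered (`stub_vacancyCapTwin`), so the stub is DERIVABLE
  as `satCensus11Glide_of_inputs stub_E1 stub_gap stub_vacancyCapTwin h₆ h₆' hP` once the three certificate-shaped cap rows are registered.
WHAT THIS IS NOT: `P5Exhaustion`, `VacancyCapTwin`, `HexVacancyCap`, `HexBlockedCap`, `GlidePocketCap` remain named inputs (numerics of record kit j336825 /
j336787, j337023 / j337020, j337021); the NARROW and CROSS pieces are untouched; F-C1 not moved.
-/

noncomputable section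

namespace Summit.Ventures.Crystal3D.Theorems

namespace TailResidue

namespace GlideCensus

open Summit.Ventures.Crystal3D Finset EndRowFloor NearIdentity FullCensus
open scoped InnerProductSpace

/-! ### §1 The kernel checks the certificate -/

/-- **The certificate is accepted by the checker** (kernel evaluation). -/
theorem certGlide_ok : runG certGlide initG = true := by
  decide +kernel

attribute [local irreducible] insertV addAll fullList ownList mirList farList tabs

variable {X : Finset (EuclideanSpace ℝ (Fin 3))} {G' : EuclideanSpace ℝ (Fin 3) ≃ₗᵢ[ℝ] EuclideanSpace ℝ (Fin 3)} {q₀ : EuclideanSpace ℝ (Fin 3)}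

/-! ### §2 The initial state -/

/-- The end ball's model point is the slot ball `3·slot 1` of the base frame. -/
theorem bG_toV : bG.toV = gBase 1 := by
  ext j; fin_cases j <;> simp [bG, Q3.toV, gBase, castQ, slot3, slotInt]

/-- Table: the twelve balls of the initial twin dozen are distinct model contacts of the reader; own slots / mirrors / far slots by menu sign. -/
theorem initG_table :
    ((ownList tabBase ⟨0, 0, 0⟩ 0 ++ mirList tabBase ⟨0, 0, 0⟩ 0).Nodup ∧ (∀ u ∈ ownList tabBase ⟨0, 0, 0⟩ 0 ++ mirList tabBase ⟨0, 0, 0⟩ 0, Q3.d2 ⟨0, 0, 0⟩ u = 18) ∧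
      (ownList tabBase ⟨0, 0, 0⟩ 0 ++ mirList tabBase ⟨0, 0, 0⟩ 0).length = 12) := by
  decide +kernel

open scoped Classical in
/-- **The initial state is interpreted**: the reader `q₀ ∈ X` twin-reads the base frame across the cube normal `0`. -/
theorem inv_initG (hX : ∀ p ∈ X, ∀ p' ∈ X, p ≠ p' → 1 ≤ dist p p') (hq0 : q₀ ∈ X)
    (hown : ∀ i : Fin 12, dz (slotInt i) (cubeInt 0) ≤ 0 → T G' q₀ (gBase i) ∈ X)
    (hmir : ∀ i : Fin 12, dz (slotInt i) (cubeInt 0) < 0 → T G' q₀ (mirQ gBase wBase i 0) ∈ X)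
    (hfar : ∀ i : Fin 12, 0 < dz (slotInt i) (cubeInt 0) → T G' q₀ (gBase i) ∉ X) : InvG X G' q₀ initG := by
  have h0 : Q3.toV ⟨0, 0, 0⟩ = 0 := by ext i; fin_cases i <;> simp [Q3.toV]
  -- the listed balls are in X
  have hlist : ∀ u ∈ ownList tabBase ⟨0, 0, 0⟩ 0 ++ mirList tabBase ⟨0, 0, 0⟩ 0, TT G' q₀ u ∈ X := by
    intro u hu
    rcases List.mem_append.1 hu with hu | hu
    · obtain ⟨i, hi, rfl⟩ := mem_ownList.1 hu
      have e := TT_add_gOf (G' := G') (q₀ := q₀) [] ⟨0, 0, 0⟩ i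
      rw [tabs_nil] at e; rw [e, h0, zero_add]
      refine hown i ?_
      have e0 : sc (i : ℕ) 0 = (dz (slotInt i) (cubeInt 0) : ℚ) := sc_eq i 0
      have := of_decide_eq_true hi; rw [e0] at this; exact_mod_cast this
    · obtain ⟨i, hi, rfl⟩ := mem_mirList.1 hu
      have e : TT G' q₀ (Q3.add ⟨0, 0, 0⟩ (mir3 (tabs []) i 0)) = T G' q₀ (Q3.toV ⟨0, 0, 0⟩ + mirQ (frameOf []).g (frameOf []).w i 0) :=
        TT_add_mir3 (G' := G') (q₀ := q₀) [] ⟨0, 0, 0⟩ i 0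
      rw [tabs_nil] at e; rw [e, h0, zero_add]
      refine hmir i ?_
      have e0 : sc (i : ℕ) 0 = (dz (slotInt i) (cubeInt 0) : ℚ) := sc_eq i 0
      have := of_decide_eq_true hi; rw [e0] at this; exact_mod_cast this
  obtain ⟨hnd, hd18, hlen⟩ := initG_table
  set C := X.filter fun z => dist (TT G' q₀ ⟨0, 0, 0⟩) z = 1 with hC
  set I := ((ownList tabBase ⟨0, 0, 0⟩ 0 ++ mirList tabBase ⟨0, 0, 0⟩ 0).map (TT G' q₀)).toFinset with hI
  have hIC : I ⊆ C := by
    intro z hz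
    rw [hI, List.mem_toFinset, List.mem_map] at hz
    obtain ⟨a, ha, rfl⟩ := hz
    exact mem_filter.2 ⟨hlist a ha, (dist_TT_eq_one_iff G' q₀ _ _).2 (hd18 a ha)⟩
  have hIcard : I.card = 12 := by
    rw [hI, List.card_toFinset, ((List.nodup_map_iff (TT_injective G' q₀)).2 hnd).dedup, List.length_map, hlen]
  have hCle : C.card ≤ 12 := card_filter_dist_eq_one_le_twelve X hX _
  have hIeq : I = C := eq_of_subset_of_card_le hIC (by rw [hIcard]; exact hCle)
  have hC12 : C.card = 12 := by rw [← hIeq, hIcard]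
  have hq12 : TT G' q₀ ⟨0, 0, 0⟩ ∈ X ∧ (X.filter fun z => dist (TT G' q₀ ⟨0, 0, 0⟩) z = 1).card = 12 := ⟨by rw [TT_origin]; exact hq0, hC12⟩
  have hcont : ∀ z ∈ X, dist (TT G' q₀ ⟨0, 0, 0⟩) z = 1 → ∃ u ∈ ownList tabBase ⟨0, 0, 0⟩ 0 ++ mirList tabBase ⟨0, 0, 0⟩ 0, z = TT G' q₀ u := by
    intro z hz hd
    have hzI : z ∈ I := by rw [hIeq]; exact mem_filter.2 ⟨hz, hd⟩
    rw [hI, List.mem_toFinset, List.mem_map] at hzI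
    obtain ⟨a, ha, rfl⟩ := hzI
    exact ⟨a, ha, rfl⟩
  exact
    { pres := by
        intro a ha
        rcases mem_addAll.1 ha with ha | ha
        · rw [List.mem_singleton.1 ha, TT_origin]; exact hq0
        · exact hlist a ha
      nodup := nodup_addAll (List.nodup_singleton _)
      sat := by intro a ha; rw [List.mem_singleton.1 ha]; exact hq12
      dzn := by
        intro pd hpd
        rw [List.mem_singleton.1 hpd]
        exact ⟨hq12, hcont⟩
      dznPres := by
        intro pd hpd u hu
        rw [List.mem_singleton.1 hpd] at hu
        exact mem_addAll.2 (Or.inr hu)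
      satPres := by intro a ha; rw [List.mem_singleton.1 ha]; exact mem_addAll.2 (Or.inl (List.mem_singleton.2 rfl))
      dznSat := by intro pd hpd; rw [List.mem_singleton.1 hpd]; exact List.mem_singleton.2 rfl
      emp := by
        intro a ha
        obtain ⟨i, hi, rfl⟩ := mem_farList.1 ha
        have e := TT_add_gOf (G' := G') (q₀ := q₀) [] ⟨0, 0, 0⟩ i
        rw [tabs_nil] at e; rw [e, h0, zero_add]
        refine hfar i ?_
        have e0 : sc (i : ℕ) 0 = (dz (slotInt i) (cubeInt 0) : ℚ) := sc_eq i 0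
        have := of_decide_eq_true hi; rw [e0] at this; exact_mod_cast this
      uns := by intro u hu; simp [initG] at hu }

open scoped Classical in
/-- **THE ENGINE.**  Under the named inputs: a `1`-separated `X` whose reader `q₀` twin-reads the base frame across the cube normal `0` and whose in-plane neighbour
`T (gBase 1)` has exactly eleven contacts, any two unsaturated ones of which coincide — is contradictory. -/
theorem engineG (hX : ∀ p ∈ X, ∀ p' ∈ X, p ≠ p' → 1 ≤ dist p p') (hE1 : P5Exhaustion) (hg : KissingGap (5 / 2)) (hcap : VacancyCapTwin)
    (hhex : HexVacancyCap) (hhexb : HexBlockedCap) (hpoc : GlidePocketCap) (hq0 : q₀ ∈ X)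
    (hown : ∀ i : Fin 12, dz (slotInt i) (cubeInt 0) ≤ 0 → T G' q₀ (gBase i) ∈ X)
    (hmir : ∀ i : Fin 12, dz (slotInt i) (cubeInt 0) < 0 → T G' q₀ (mirQ gBase wBase i 0) ∈ X)
    (hfar : ∀ i : Fin 12, 0 < dz (slotInt i) (cubeInt 0) → T G' q₀ (gBase i) ∉ X)
    (h11 : (X.filter fun z => dist (T G' q₀ (gBase 1)) z = 1).card = 11)
    (hone : ∀ y ∈ X, ∀ y' ∈ X, dist (T G' q₀ (gBase 1)) y = 1 → dist (T G' q₀ (gBase 1)) y' = 1 →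
      (X.filter fun z => dist y z = 1).card ≤ 11 → (X.filter fun z => dist y' z = 1).card ≤ 11 → y = y') : False := by
  have hb : TT G' q₀ bG = T G' q₀ (gBase 1) := by rw [TT, bG_toV]
  have hbX : T G' q₀ (gBase 1) ∈ X := hown 1 (by decide)
  have hyp : HypG X G' q₀ :=
    { sep := hX, e1 := hE1, gap := hg, cap := hcap, hex := hhex, hexb := hhexb, pocket := hpoc, bmem := by rw [hb]; exact hbX,
      deg := by rw [hb]; exact h11, one := by rw [hb]; exact hone }
  exact runG_sound hyp certGlide initG (inv_initG hX hq0 hown hmir hfar) certGlide_ok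

/-! ### §3 The 48 (slot, normal) symmetries of the model, and the census theorem -/

/-- For each pair (slot `j`, cube normal `c`) with `slot j ⊥ normal c`: a chain of rational model reflections carrying (slot `1`, normal `0`) to it. -/
def glideSymList : List (ℕ × ℕ × List (Fin 3 → ℚ)) :=
  [(0, 2, [![0, 1, 0]]), (0, 3, [![0, 1, 0], ![0, 0, 1]]), (0, 4, [![1, 0, 0], ![1, 1, 0]]), (0, 5, [![1, 0, 0], ![0, 0, 1], ![1, 1, 0]]), (1, 0, []), (1, 1, [![0, 0, 1]]), (1, 6, [![1, 1, 0]]), (1, 7, [![0, 0, 1], ![1, 1, 0]]), (2, 0, [![1, (-1), 0]]), (2, 1, [![0, 0, 1], ![1, (-1), 0]]), (2, 6, [![1, 0, 0], ![0, 1, 0]]), (2, 7, [![1, 0, 0], ![0, 1, 0], ![0, 0, 1]]), (3, 2, [![1, 0, 0], ![1, (-1), 0]]), (3, 3, [![1, 0, 0], ![0, 0, 1], ![1, (-1), 0]]), (3, 4, [![1, 0, 0]]), (3, 5, [![1, 0, 0], ![0, 0, 1]]), (4, 1, [![0, 1, 0], ![0, 1, (-1)]]), (4, 3, [![0, 1,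 1]]), (4, 4, [![1, 0, 0], ![0, 1, (-1)], ![1, 0, 1]]), (4, 6, [![1, 0, (-1)], ![1, 1, 0]]), (5, 0, [![0, 1, (-1)]]), (5, 2, [![0, 1, 0], ![0, 1, 1]]), (5, 5, [![0, 1, (-1)], ![1, 0, 1]]), (5, 7, [![1, 0, 0], ![1, 0, (-1)], ![1, 1, 0]]), (6, 0, [![1, (-1), 0], ![0, 1, (-1)]]), (6, 2, [![1, 0, 0], ![1, (-1), 0], ![0, 1, 1]]), (6, 5, [![1, 0, 0], ![0, 1, 0], ![0, 1, (-1)]]), (6, 7, [![1, 0, 0], ![0, 1, 1]]), (7, 1, [![1, 0, 0], ![1, (-1), 0], ![0, 1, (-1)]]), (7, 3, [![1, (-1), 0], ![0, 1, 1]]), (7, 4, [![1, 0, 0], ![0, 1, (-1)]]), (7, 6, [![1, 0, 0], ![0, 1, 0], ![0, 1, 1]]), (8, 1, [![1, 0, 0], ![1, 0, (-1)], ![0, 1, 1]]), (8, 2, [![0, 1, 0], ![1, 0, (-1)]]), (8, 5, [![1, (-1), 0], ![1, 0, 1]]), (8, 6, [![1, 0, 0], ![0, 1, 0], ![1, 0,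 1]]), (9, 0, [![1, (-1), 0], ![1, 0, (-1)]]), (9, 3, [![1, 0, 0], ![0, 1, 0], ![1, 0, (-1)]]), (9, 4, [![1, 0, 0], ![0, 1, (-1)], ![1, 1, 0]]), (9, 7, [![0, 1, 0], ![1, 0, 1]]), (10, 0, [![1, 0, (-1)]]), (10, 3, [![1, 0, (-1)], ![0, 1, 1]]), (10, 4, [![1, 0, 0], ![1, 0, 1]]), (10, 7, [![1, 0, 0], ![1, (-1), 0], ![1, 0, 1]]), (11, 1, [![1, 0, 0], ![1, 0, (-1)]]), (11, 2, [![1, 0, 0], ![1, (-1), 0], ![1, 0, (-1)]]), (11, 5, [![1, 0, 1]]), (11, 6, [![0, 1, (-1)], ![1, 1, 0]])]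

/-- The chain of the pair `(j, c)`. -/
def glideSym (j c : ℕ) : List (Fin 3 → ℚ) := ((glideSymList.filter fun e => e.1 = j ∧ e.2.1 = c).head?.map fun e => e.2.2).getD []

/-- Table: for every orthogonal pair the chain is non-degenerate, carries `3·slot 1 ↦ 3·slot j` and `normal 0 ↦ normal c`, permutes the base slot images
preserving the menu values against the normal, and carries the base mirrors across normal `0` to the base mirrors across normal `c`. -/
theorem glide_sym_table : ∀ j : Fin 12, ∀ c : Fin 8, dz (slotInt j) (cubeInt c) = 0 →
    (∀ n ∈ glideSym j c, dq n n ≠ 0) ∧ msym (glideSym j c) (gBase 1) = gBase j ∧ msym (glideSym j c) (wBase 0) = wBase c ∧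
    ∀ i : Fin 12, ∃ i' : Fin 12, msym (glideSym j c) (gBase i) = gBase i' ∧ dz (slotInt i') (cubeInt c) = dz (slotInt i) (cubeInt 0) ∧
      msym (glideSym j c) (mirQ gBase wBase i 0) = mirQ gBase wBase i' c := by
  decide +kernel

/-- `PQ` of a base slot image is the base frame's slot vector. -/
theorem PQ_gBase (k : Fin 12) : PQ (gBase k) = L (slotSite k) := by
  rw [← L_symm_PQ_gBase k, LinearIsometryEquiv.apply_symm_apply]

open scoped Classical in
/-- **`SatCensus11Glide` FROM E1, GAP(5/2), THE TWIN VACANCY CAP, THE TWO HEX CAP ROWS AND THE POCKET ROWS.**  At a deg-11 (A)-end ball `b = q + d` of a GLIDE move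
(`q` twin-reads `(G, m)`, `⟪d, m⟫ = 0`, admissible slot class `(G, d)`), two distinct contact-neighbours of `b` have at most eleven contacts.  (The two-payer clause, the
predecessor, the non-moving clause and the word version are not used.) -/
theorem satCensus11Glide_of_inputs (hE1 : P5Exhaustion) (hg : KissingGap (5 / 2)) (hcap : VacancyCapTwin) (hhex : HexVacancyCap) (hhexb : HexBlockedCap)
    (hpoc : GlidePocketCap) : SatCensus11Glide := by
  intro X hX _ S₁ S₂ h₁ h₂ b q G d hq _ _ hadm _ hrd hbq _ h11
  obtain ⟨m, htr, hdm⟩ := hrd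
  by_contra hcon
  -- the class slot
  obtain ⟨u, hu, rfl⟩ : ∃ w ∈ fccSlots, d = G w := by
    rcases hadm with h | h
    · exact (exists_slots_of_adm h₁ h).1
    · exact (exists_slots_of_adm h₂ h).1
  obtain ⟨j, rfl⟩ := exists_slotSite_eq hu
  -- the reading normal is a model normal of G
  have hGeq : G = L.trans (L.symm.trans G) := by ext x; simp
  have hmn : IsMenuNormal L ((L.symm.trans G).symm m) := by
    have h := htr.1
    rw [hGeq] at h
    exact (isMenuNormal_trans_iff L (L.symm.trans G) m).1 h
  obtain ⟨c, hc⟩ := exists_menuOf_of_menu hmn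
  have hm : m = G (L.symm (menuOf (cubeInt c))) := by
    have : (L.symm.trans G) ((L.symm.trans G).symm m) = m := LinearIsometryEquiv.apply_symm_apply _ _
    rw [hc] at this
    rw [← this]; rfl
  -- menu values of G-slots against m
  have hval : ∀ i : Fin 12, ⟪G (slotSite i), m⟫_ℝ = (dz (slotInt i) (cubeInt c) : ℝ) / Real.sqrt 6 := by
    intro i
    rw [hm, LinearIsometryEquiv.inner_map_map, ← LinearIsometryEquiv.inner_map_map L (slotSite i), LinearIsometryEquiv.apply_symm_apply,
      inner_L_slotSite_menuOf]
  -- d ⊥ m gives an orthogonal pair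
  have hjc : dz (slotInt j) (cubeInt c) = 0 := by
    have h := hval j
    rw [hdm] at h
    have h6 : (0 : ℝ) < Real.sqrt 6 := sqrt6_pos
    have : ((dz (slotInt j) (cubeInt c) : ℤ) : ℝ) = 0 := by
      field_simp at h; linarith
    exact_mod_cast this
  obtain ⟨hns, h1, hw0, hperm⟩ := glide_sym_table j c hjc
  -- the symmetrised frame
  set ns := glideSym j c with hnsdef
  set Ψ : EuclideanSpace ℝ (Fin 3) ≃ₗᵢ[ℝ] EuclideanSpace ℝ (Fin 3) := Qr.symm.trans ((Msym ns).trans (Qr.trans L.symm)) with hΨ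
  set G₁ : EuclideanSpace ℝ (Fin 3) ≃ₗᵢ[ℝ] EuclideanSpace ℝ (Fin 3) := Ψ.trans G with hG₁
  have hG₁v : ∀ w : Fin 3 → ℚ, G₁ (Qr (iptQ w)) = G (L.symm (Qr (iptQ (msym ns w)))) := by
    intro w
    simp only [hG₁, hΨ, LinearIsometryEquiv.trans_apply, LinearIsometryEquiv.symm_apply_apply, Msym_iptQ _ hns]
  have hT : ∀ w : Fin 3 → ℚ, T G₁ q w = q + G (L.symm (PQ (msym ns w))) := by
    intro w; rw [T, PQ, hG₁v]; rfl
  -- nv (wBase c) is the reading normal's model vector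
  have hnv : G (L.symm (nv (wBase c))) = m := by rw [hm, wBase, ← menuOf_eq_nv]
  have hLn : ∀ i : Fin 12, ⟪L (slotSite i), nv (wBase c)⟫_ℝ = ⟪G (slotSite i), m⟫_ℝ := by
    intro i; rw [hval, wBase, ← menuOf_eq_nv, inner_L_slotSite_menuOf]
  -- slots and mirrors of the symmetrised frame
  have hslotT : ∀ i : Fin 12, ∃ i' : Fin 12, dz (slotInt i') (cubeInt c) = dz (slotInt i) (cubeInt 0) ∧ T G₁ q (gBase i) = q + G (slotSite i') ∧
      T G₁ q (mirQ gBase wBase i 0) = q + (G (slotSite i') - (2 * ⟪G (slotSite i'), m⟫_ℝ) • m) := by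
    intro i
    obtain ⟨i', hi', hval', hmir'⟩ := hperm i
    refine ⟨i', hval', by rw [hT, hi', L_symm_PQ_gBase], ?_⟩
    have em : L (slotSite i') - (2 * ⟪L (slotSite i'), nv (wBase c)⟫_ℝ) • nv (wBase c) = Qr (iptQ (mirQ gBase wBase i' c)) :=
      RatFrame.mirror_eq RatFrame.base i' c
    rw [hT, hmir', PQ, ← em, map_sub, map_smul, LinearIsometryEquiv.symm_apply_apply, map_sub, map_smul, hnv, hLn]
  have h6 : (0 : ℝ) < Real.sqrt 6 := sqrt6_pos
  have hown : ∀ i : Fin 12, dz (slotInt i) (cubeInt 0) ≤ 0 → T G₁ q (gBase i) ∈ X := by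
    intro i hi
    obtain ⟨i', hval', hT', -⟩ := hslotT i
    rw [hT']
    refine htr.2.1 _ (slotSite_mem i') ?_
    rw [hval i', hval']
    exact div_nonpos_of_nonpos_of_nonneg (by exact_mod_cast hi) h6.le
  have hmir : ∀ i : Fin 12, dz (slotInt i) (cubeInt 0) < 0 → T G₁ q (mirQ gBase wBase i 0) ∈ X := by
    intro i hi
    obtain ⟨i', hval', -, hT'⟩ := hslotT i
    rw [hT']
    refine htr.2.2.1 _ (slotSite_mem i') ?_
    rw [hval i', hval']
    exact div_neg_of_neg_of_pos (by exact_mod_cast hi) h6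
  have hfar : ∀ i : Fin 12, 0 < dz (slotInt i) (cubeInt 0) → T G₁ q (gBase i) ∉ X := by
    intro i hi
    obtain ⟨i', hval', hT', -⟩ := hslotT i
    rw [hT']
    refine htr.2.2.2 _ (slotSite_mem i') ?_
    rw [hval i', hval']
    exact div_pos (by exact_mod_cast hi) h6
  have hbT : T G₁ q (gBase 1) = b := by rw [hT, h1, L_symm_PQ_gBase, hbq]
  refine engineG (G' := G₁) hX hE1 hg hcap hhex hhexb hpoc hq hown hmir hfar (by rw [hbT]; exact h11) ?_
  intro y hy y' hy' hd hd' hc hc'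
  rw [hbT] at hd hd'
  by_contra hne
  exact hcon ⟨y, hy, y', hy', hne, hd, hd', hc, hc'⟩

end GlideCensus

end TailResidue

end Summit.Ventures.Crystal3D.Theorems

end
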